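import Summits.QuantumFields.QCD.Theorems.GaussianLinkFramesFrameFMClosurePlacementCollarAux5

/-!
# Crux `GaussianLinkFrames.FrameFMClosure` (stmt-QuantumFields-17375), line `pad-the-fibre`, stub
`stub_placementCollar` — helper 6: the balanced canonical (collar) placement on the torus

`collar_placement`: on the odd torus of side `2S+1`, for the thick collar `W = ebox x ℓ ⊂ Λ = ebox x (3ℓ+2)`
(`1 ≤ ℓ`, `3ℓ+4 ≤ S`) and two points `u' = φ a_u`, `v = φ a_v` of `Λ ∖ W` (chart `φ a = x + proj a`), there are pad
centres `x', y'` holding `u', v` in their cores and canonical pad regions `Q₁, Q₂` about them (`IsPadRegion`) such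
that the region `R = star(u') ∪ star(v) ∪ Q₁ ∪ Q₂` has `≤ 2064` links, NO link inside `W`, none inside `Λᶜ`, and a
BALANCED touched region `touched S univ R` — the integer recipe of helpers 1–4 (one pad per point, frozen layers
inside `W` / outside `Λ`, one extra rung per defect, the aligned/complementary `0`-flips as the pairing) transported
by the dictionary of helper 5.  This is everything `PaddedCofactorDominationLarge` asks of a (collar) placement.

References: placement recipe of the line card `pad-the-fibre` (triage r1-1 sharpen 1); elementary [folklore].
-/

noncomputable section

open scoped BigOperators
open Literature.MathematicalPhysics.QuantumFieldTheory Literature.MathematicalPhysics.QuantumLattice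
  Literature.Probability.LatticeModels
open Summit.QuantumFields.QCD.Theorems.VonMisesCircles Summit.QuantumFields.QCD.Theorems.PadTheFibre
  Summit.QuantumFields.QCD.Theorems.PadTheFibreTwoStar

namespace Summit.QuantumFields.QCD.Theorems.PadTheFibreCollar

/-- A region whose links are `(b + w, μ)` with `w ∈ [-2,1]⁴` has at most `1024` links. [folklore] -/
theorem card_region_le (b : Literature.Probability.LatticeModels.Site 4)
    (Q : Finset (Literature.Probability.LatticeModels.Site 4 × Fin 4))
    (h : ∀ q ∈ Q, ∃ w : Literature.Probability.LatticeModels.Site 4, (∀ i, -2 ≤ w i ∧ w i ≤ 1) ∧ q.1 = b + w) :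
    Q.card ≤ 1024 := by
  classical
  obtain ⟨t, ht⟩ : ∃ t : Finset (Literature.Probability.LatticeModels.Site 4 × Fin 4),
      t = (Fintype.piFinset fun _ : Fin 4 => Finset.Icc (-2 : ℤ) 1) ×ˢ (Finset.univ : Finset (Fin 4)) := ⟨_, rfl⟩
  have htc : t.card = 1024 := by
    have hIcc : (Finset.Icc (-2 : ℤ) 1).card = 4 := by rw [Int.card_Icc]; rfl
    rw [ht, Finset.card_product, Fintype.card_piFinset, Finset.prod_const, Finset.card_univ, Fintype.card_fin, hIcc]
    norm_num
  have hinj : Function.Injective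
      (fun q : Literature.Probability.LatticeModels.Site 4 × Fin 4 => (q.1 - b, q.2)) := by
    intro q₁ q₂ h
    simp only [Prod.mk.injEq, sub_left_inj] at h
    exact Prod.ext h.1 h.2
  rw [← Finset.card_image_of_injective Q hinj, ← htc]
  refine Finset.card_le_card fun p hp => ?_
  obtain ⟨q, hq, rfl⟩ := Finset.mem_image.1 hp
  obtain ⟨w, hw, hq1⟩ := h q hq
  rw [ht, Finset.mem_product, Fintype.mem_piFinset]
  refine ⟨fun i => Finset.mem_Icc.2 ?_, Finset.mem_univ _⟩
  have : (q.1 - b) i = w i := by rw [hq1]; simp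
  show -2 ≤ (q.1 - b) i ∧ (q.1 - b) i ≤ 1
  rw [this]
  exact hw i

/-- **The balanced canonical collar placement.** [folklore] -/
theorem collar_placement {S : ℕ} (x : TorusSite 4 (2 * S + 1)) (ℓ : ℕ) (hℓ : 1 ≤ ℓ) (hℓS : 3 * ℓ + 4 ≤ S)
    (au av : Literature.Probability.LatticeModels.Site 4)
    (hau : ∀ i, -(3 * (ℓ : ℤ) + 3) ≤ au i ∧ au i ≤ 3 * ℓ + 2) (hauW : ¬ ∀ i, -(ℓ : ℤ) - 1 ≤ au i ∧ au i ≤ ℓ)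
    (hav : ∀ i, -(3 * (ℓ : ℤ) + 3) ≤ av i ∧ av i ≤ 3 * ℓ + 2) (havW : ¬ ∀ i, -(ℓ : ℤ) - 1 ≤ av i ∧ av i ≤ ℓ) :
    ∃ (x' y' : TorusSite 4 (2 * S + 1)) (Q₁ Q₂ : Finset (Edge 4 (2 * S + 1))),
      x + Torus.proj (2 * S + 1) au ∈ ebox S x' 0 ∧ x + Torus.proj (2 * S + 1) av ∈ ebox S y' 0 ∧
      IsPadRegion S x' Q₁ ∧ IsPadRegion S y' Q₂ ∧
      Balanced (touched S Finset.univ (starLinks S (x + Torus.proj (2 * S + 1) au) ∪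
        starLinks S (x + Torus.proj (2 * S + 1) av) ∪ Q₁ ∪ Q₂)) ∧
      (starLinks S (x + Torus.proj (2 * S + 1) au) ∪ starLinks S (x + Torus.proj (2 * S + 1) av) ∪ Q₁ ∪ Q₂).card
        ≤ 2064 ∧
      (∀ e ∈ starLinks S (x + Torus.proj (2 * S + 1) au) ∪ starLinks S (x + Torus.proj (2 * S + 1) av) ∪ Q₁ ∪ Q₂,
        ¬ (e.1 ∈ ebox S x ℓ ∧ Site.shift e.1 e.2 ∈ ebox S x ℓ)) ∧
      (∀ e ∈ starLinks S (x + Torus.proj (2 * S + 1) au) ∪ starLinks S (x + Torus.proj (2 * S + 1) av) ∪ Q₁ ∪ Q₂,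
        ¬ (e.1 ∈ (ebox S x (3 * ℓ + 2))ᶜ ∧ Site.shift e.1 e.2 ∈ (ebox S x (3 * ℓ + 2))ᶜ)) := by
  classical
  obtain ⟨bu, cu, Mu, Qu, Zu, Du, h1u, h2u, h3u, h4u, h5u, h6u, h7u, h8u, h9u, h10u, h11u, h12u, h13u⟩ :=
    collar_point_package ℓ hℓ au hau hauW
  obtain ⟨bv, cv, Mv, Qv, Zv, Dv, h1v, h2v, h3v, h4v, h5v, h6v, h7v, h8v, h9v, h10v, h11v, h12v, h13v⟩ :=
    collar_point_package ℓ hℓ av hav havW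
  obtain ⟨hVu, hLu⟩ := collar_point_links ℓ au bu cu Mu Qu Zu Du hau hauW h2u h5u h6u h7u h8u
  obtain ⟨hVv, hLv⟩ := collar_point_links ℓ av bv cv Mv Qv Zv Dv hav havW h2v h5v h6v h7v h8v
  -- the integer link sets of the two placements
  obtain ⟨Ru, hRu⟩ : ∃ Ru : Finset (Literature.Probability.LatticeModels.Site 4 × Fin 4), Ru =
    (Finset.univ.image fun μ : Fin 4 => (au, μ)) ∪ (Finset.univ.image fun μ : Fin 4 => (au - Pi.single μ 1, μ)) ∪ Qu :=
    ⟨_, rfl⟩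
  obtain ⟨Rv, hRv⟩ : ∃ Rv : Finset (Literature.Probability.LatticeModels.Site 4 × Fin 4), Rv =
    (Finset.univ.image fun μ : Fin 4 => (av, μ)) ∪ (Finset.univ.image fun μ : Fin 4 => (av - Pi.single μ 1, μ)) ∪ Qv :=
    ⟨_, rfl⟩
  rw [← hRu] at hVu hLu
  rw [← hRv] at hVv hLv
  have hwu : ∀ i, -(S : ℤ) + 2 ≤ bu i ∧ bu i ≤ S - 2 := fun i => by have := h2u i; omega
  have hwv : ∀ i, -(S : ℤ) + 2 ≤ bv i ∧ bv i ≤ S - 2 := fun i => by have := h2v i; omega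
  refine ⟨x + Torus.proj (2 * S + 1) bu, x + Torus.proj (2 * S + 1) bv,
    Qu.image fun q => ((x + Torus.proj (2 * S + 1) q.1, q.2) : Edge 4 (2 * S + 1)),
    Qv.image fun q => ((x + Torus.proj (2 * S + 1) q.1, q.2) : Edge 4 (2 * S + 1)), ?_, ?_, ?_, ?_, ?_⟩
  · exact mem_ebox_core_chart x au bu h1u
  · exact mem_ebox_core_chart x av bv h1v
  · exact isPadRegion_chart x bu hwu Mu cu h3u Qu h4u h5u
  · exact isPadRegion_chart x bv hwv Mv cv h3v Qv h4v h5v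
  -- the region is the image of `Ru ∪ Rv`
  have hR : starLinks S (x + Torus.proj (2 * S + 1) au) ∪ starLinks S (x + Torus.proj (2 * S + 1) av) ∪
      (Qu.image fun q => ((x + Torus.proj (2 * S + 1) q.1, q.2) : Edge 4 (2 * S + 1))) ∪
      (Qv.image fun q => ((x + Torus.proj (2 * S + 1) q.1, q.2) : Edge 4 (2 * S + 1))) =
      (Ru ∪ Rv).image fun q => ((x + Torus.proj (2 * S + 1) q.1, q.2) : Edge 4 (2 * S + 1)) := by
    rw [starLinks_chart, starLinks_chart, hRu, hRv]
    simp only [Finset.image_union]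
    ext e
    simp only [Finset.mem_union]
    constructor
    · rintro (((h | h) | h) | h)
      · exact Or.inl (Or.inl h)
      · exact Or.inr (Or.inl h)
      · exact Or.inl (Or.inr h)
      · exact Or.inr (Or.inr h)
    · rintro ((h | h) | (h | h))
      · exact Or.inl (Or.inl (Or.inl h))
      · exact Or.inl (Or.inr h)
      · exact Or.inl (Or.inl (Or.inr h))
      · exact Or.inr h
  -- properties of the integer links
  have hL : ∀ q ∈ Ru ∪ Rv,
      (∀ i, -(3 * (ℓ : ℤ) + 4) ≤ q.1 i ∧ q.1 i ≤ 3 * ℓ + 3) ∧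
      (∀ i, -(3 * (ℓ : ℤ) + 4) ≤ (q.1 + Pi.single q.2 1 : Literature.Probability.LatticeModels.Site 4) i ∧
        (q.1 + Pi.single q.2 1 : Literature.Probability.LatticeModels.Site 4) i ≤ 3 * ℓ + 3) ∧
      ¬ ((∀ i, -(ℓ : ℤ) - 1 ≤ q.1 i ∧ q.1 i ≤ ℓ) ∧
        (∀ i, -(ℓ : ℤ) - 1 ≤ (q.1 + Pi.single q.2 1 : Literature.Probability.LatticeModels.Site 4) i ∧
          (q.1 + Pi.single q.2 1 : Literature.Probability.LatticeModels.Site 4) i ≤ ℓ)) ∧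
      ((∀ i, -(3 * (ℓ : ℤ) + 3) ≤ q.1 i ∧ q.1 i ≤ 3 * ℓ + 2) ∨
        (∀ i, -(3 * (ℓ : ℤ) + 3) ≤ (q.1 + Pi.single q.2 1 : Literature.Probability.LatticeModels.Site 4) i ∧
          (q.1 + Pi.single q.2 1 : Literature.Probability.LatticeModels.Site 4) i ≤ 3 * ℓ + 2)) := by
    intro q hq
    rcases Finset.mem_union.1 hq with hq | hq
    · exact hLu q hq
    · exact hLv q hq
  have hshift : ∀ q : Literature.Probability.LatticeModels.Site 4 × Fin 4,
      Site.shift (x + Torus.proj (2 * S + 1) q.1) q.2 = x + Torus.proj (2 * S + 1) (q.1 + Pi.single q.2 1) := by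
    intro q
    show _ + Pi.single q.2 1 = _
    rw [(proj_add_single_sub_single _ q.1 q.2).1, add_assoc]
  refine ⟨?_, ?_, ?_, ?_⟩
  · -- balance
    rw [hR, touched_univ_chart]
    have hT : (Ru ∪ Rv).image Prod.fst ∪ (Ru ∪ Rv).image (fun q => q.1 + Pi.single q.2 1) =
        (Zu ∪ Du) ∪ (Zv ∪ Dv) := by
      ext y
      simp only [Finset.mem_union, Finset.mem_image]
      rw [← hVu y, ← hVv y]
      constructor
      · rintro (⟨q, hq | hq, rfl⟩ | ⟨q, hq | hq, rfl⟩)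
        · exact Or.inl ⟨q, hq, Or.inl rfl⟩
        · exact Or.inr ⟨q, hq, Or.inl rfl⟩
        · exact Or.inl ⟨q, hq, Or.inr rfl⟩
        · exact Or.inr ⟨q, hq, Or.inr rfl⟩
      · rintro (⟨q, hq, h | h⟩ | ⟨q, hq, h | h⟩)
        · exact Or.inl ⟨q, Or.inl hq, h⟩
        · exact Or.inr ⟨q, Or.inl hq, h⟩
        · exact Or.inl ⟨q, Or.inr hq, h⟩
        · exact Or.inr ⟨q, Or.inr hq, h⟩
    rw [hT]
    obtain ⟨τ, hτ⟩ : ∃ τ : Literature.Probability.LatticeModels.Site 4 → Literature.Probability.LatticeModels.Site 4,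
        ∀ y, τ y = if (y 0 - (ℓ : ℤ)) % 2 = 0 then y + Pi.single 0 1 else y - Pi.single 0 1 := ⟨_, fun _ => rfl⟩
    obtain ⟨τ', hτ'⟩ : ∃ τ' : Literature.Probability.LatticeModels.Site 4 → Literature.Probability.LatticeModels.Site 4,
        ∀ y, τ' y = if (y 0 - (ℓ : ℤ)) % 2 = 0 then y - Pi.single 0 1 else y + Pi.single 0 1 := ⟨_, fun _ => rfl⟩
    obtain ⟨σ, hσ⟩ : ∃ σ : Literature.Probability.LatticeModels.Site 4 → Literature.Probability.LatticeModels.Site 4,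
        ∀ y, σ y = if y ∈ Du ∪ Dv then τ' y else τ y := ⟨_, fun _ => rfl⟩
    have hP := collar_pairing ℓ Zu Du Zv Dv τ τ' σ hτ hτ' hσ
      (fun y hy => by rw [hτ]; exact h9u y hy) (fun y hy => by rw [hτ']; exact h10u y hy) h11u h12u
      (fun y hy => by rw [hτ]; exact h9v y hy) (fun y hy => by rw [hτ']; exact h10v y hy) h11v h12v
    refine balanced_chart_image x _ (fun y hy i => ?_) σ (fun y hy => (hP y hy).1) (fun y hy => (hP y hy).2.1)
      (fun y hy => (hP y hy).2.2)
    have hy' : (y ∈ Zu ∨ y ∈ Du) ∨ (y ∈ Zv ∨ y ∈ Dv) := by simpa only [Finset.mem_union] using hy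
    rcases hy' with hy' | hy'
    · have := h13u y hy' i; omega
    · have := h13v y hy' i; omega
  · -- link budget
    rw [hR]
    refine Finset.card_image_le.trans ((Finset.card_union_le _ _).trans ?_)
    have hstar : ∀ a : Literature.Probability.LatticeModels.Site 4,
        ((Finset.univ.image fun μ : Fin 4 => (a, μ)) ∪
          (Finset.univ.image fun μ : Fin 4 => (a - Pi.single μ 1, μ))).card ≤ 8 := by
      intro a
      have h1 : (Finset.univ.image fun μ : Fin 4 => (a, μ)).card ≤ 4 :=
        Finset.card_image_le.trans (by rw [Finset.card_univ, Fintype.card_fin])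
      have h2 : (Finset.univ.image fun μ : Fin 4 => (a - Pi.single μ 1, μ)).card ≤ 4 :=
        Finset.card_image_le.trans (by rw [Finset.card_univ, Fintype.card_fin])
      exact (Finset.card_union_le _ _).trans (by omega)
    have hcu := (Finset.card_union_le _ _).trans (Nat.add_le_add (hstar au)
      (card_region_le bu Qu fun q hq => (h5u q hq).imp fun w hw => ⟨hw.1, hw.2.2.1⟩))
    have hcv := (Finset.card_union_le _ _).trans (Nat.add_le_add (hstar av)
      (card_region_le bv Qv fun q hq => (h5v q hq).imp fun w hw => ⟨hw.1, hw.2.2.1⟩))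
    rw [hRu, hRv]
    omega
  · -- no link inside `W`
    intro e he
    rw [hR] at he
    obtain ⟨q, hq, rfl⟩ := Finset.mem_image.1 he
    obtain ⟨hw1, hw2, hW, -⟩ := hL q hq
    rintro ⟨h1, h2⟩
    rw [hshift] at h2
    refine hW ⟨(mem_ebox_chart x q.1 ℓ).2 (by omega) (fun i => by have := hw1 i; omega) h1,
      (mem_ebox_chart x _ ℓ).2 (by omega) (fun i => by have := hw2 i; omega) h2⟩
  · -- no link inside `Λᶜ`
    intro e he
    rw [hR] at he
    obtain ⟨q, hq, rfl⟩ := Finset.mem_image.1 he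
    obtain ⟨-, -, -, hΛ | hΛ⟩ := hL q hq
    · rintro ⟨h1, -⟩
      exact Finset.mem_compl.1 h1 ((mem_ebox_chart x q.1 (3 * ℓ + 2)).1 fun i => by
        have := hΛ i; push_cast; omega)
    · rintro ⟨-, h2⟩
      rw [hshift] at h2
      exact Finset.mem_compl.1 h2 ((mem_ebox_chart x _ (3 * ℓ + 2)).1 fun i => by
        have := hΛ i; push_cast; omega)

/-- **Registered helper `stub_placementCollar_aux6` of crux stmt-QuantumFields-17375** (line `pad-the-fibre`, stub
`stub_placementCollar`): the balanced canonical collar placement on the torus — one line (`collar_placement`). [folklore] -/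
theorem stub_placementCollar_aux6 : ∀ (S : ℕ) (x : TorusSite 4 (2 * S + 1)) (ℓ : ℕ) (_ : 1 ≤ ℓ) (_ : 3 * ℓ + 4 ≤ S) (au av : Literature.Probability.LatticeModels.Site 4) (_ : ∀ i, -(3 * (ℓ : ℤ) + 3) ≤ au i ∧ au i ≤ 3 * ℓ + 2) (_ : ¬ ∀ i, -(ℓ : ℤ) - 1 ≤ au i ∧ au i ≤ ℓ) (_ : ∀ i, -(3 * (ℓ : ℤ) + 3) ≤ av i ∧ av i ≤ 3 * ℓ + 2) (_ : ¬ ∀ i, -(ℓ : ℤ) - 1 ≤ av i ∧ av i ≤ ℓ), ∃ (x' y' : TorusSite 4 (2 * S + 1)) (Q₁ Q₂ : Finset (Edge 4 (2 * S + 1))), x + Torus.proj (2 * S + 1) au ∈ ebox S x' 0 ∧ x + Torus.proj (2 * S + 1) av ∈ ebox S y' 0 ∧ IsPadRegion S x' Q₁ ∧ IsPadRegion S y' Q₂ ∧ Balanced (touched S Finset.univ (starLinks S (x + Torus.proj (2 * S + 1) au) ∪ starLinks S (x + Torus.proj (2 * S + 1) av) ∪ Q₁ ∪ Q₂)) ∧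 (starLinks S (x + Torus.proj (2 * S + 1) au) ∪ starLinks S (x + Torus.proj (2 * S + 1) av) ∪ Q₁ ∪ Q₂).card ≤ 2064 ∧ (∀ e ∈ starLinks S (x + Torus.proj (2 * S + 1) au) ∪ starLinks S (x + Torus.proj (2 * S + 1) av) ∪ Q₁ ∪ Q₂, ¬ (e.1 ∈ ebox S x ℓ ∧ Site.shift e.1 e.2 ∈ ebox S x ℓ)) ∧ (∀ e ∈ starLinks S (x + Torus.proj (2 * S + 1) au) ∪ starLinks S (x + Torus.proj (2 * S + 1) av) ∪ Q₁ ∪ Q₂, ¬ (e.1 ∈ (ebox S x (3 * ℓ + 2))ᶜ ∧ Site.shift e.1 e.2 ∈ (ebox S x (3 * ℓ + 2))ᶜ)) :=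
  fun S x => collar_placement (S := S) x

end Summit.QuantumFields.QCD.Theorems.PadTheFibreCollar

end
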